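import Summits.ResolutionOfSingularities.ResolutionOfSingularities.Theorems.FrobeniusLadderFInjectiveMacaulayficationNonFullLoopFloorFiveCentre
import Summits.ResolutionOfSingularities.ResolutionOfSingularities.Theorems.FrobeniusLadderFInjectiveMacaulayficationNonFullLoopFloorThree
import Summits.ResolutionOfSingularities.ResolutionOfSingularities.Theorems.FrobeniusLadderFInjectiveMacaulayficationStrictTransformChartSub
import HarnessLib

/-!
# NEG-N, FLOOR 2 (chart step and the bad half of the locus lemma): `U₂ = Spec k[x,y,u,t,z]/(g₂)`, `g₂ = z² + x⁴z + x²(y³+u³+t³)`, centre `S₂ = (x, z)`;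
# the `x`-chart of `Bl_{(x̄,z̄)} U₂` is `U₃ = Spec k[X]/(g₃)`, `g₃ = z² + x³z + y³+u³+t³`; EVERY point of `V(x̄, z̄) ⊂ U₂` is NOT FULL
# (crux `FInjectiveMacaulayfication` stmt-ResolutionOfSingularities-15315, chain w45a; res-L1-w45a-plan-1 g19 RULINGs R19.21 «NEG-N: an unconditional kernel
# refutation of `Recipes.NonFullTowerConjecture` on the period-one bed d4lx6c3» / R19.22 (floor split: NEG-0, NEG-2, NEG-4 → stub-3); floor table =
# res-L1-w45a-tri-2 g16's replay (`k = 2: g₂, I₁ = (xt, xu, xy, x², z), S₂ = (x, z), Bl (x,z) @x`); letters = res-L1-w45a-stub-1's ✓ `…NonFullLoopFloorOne` (`g₂`),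
# `…NonFullLoopFloorThree` (`g₃`) and `…NonFullLoopFloorFiveCentre` (coordinate primes, the `F[ε]` witness); seat res-L1-w45a-stub-3 g10)

[OURS · L1 W4.5a] Support file (`--supports stmt-ResolutionOfSingularities-15315 --as helper`); replaces the role of NO printed item; NOT a statement of any
manuscript; def-free (the floor polynomials are hypotheses `g₂ g₃` with their defining equations); UNCONDITIONAL; §1–§3 over ANY field except where `(g₃)` prime is
used (`CharP k 2`, from `…NonFullLoopFloorThree.prime_g₃`); §4 `CharP k 2`. AI-written (AI review is weaker than expert review).

`X 0 = x`, `X 1 = y`, `X 2 = u`, `X 3 = t`, `X 4 = z`; `A = k[X]/(g₂)`; the centre `𝔮 = (x̄, z̄)` is spelled `Ideal.span ((fun j => mk (X j)) '' ↑({0, 4} : Finset (Fin 5)))`.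
* §1 ★ `theta_x` — the SUB-CENTRE chart identity `g₂(x, y, u, t, xz) = x²·g₃` (`Λ = {0,4}`, `i = 0`; `ring`); `g₂_mem_span_X_image`, `mk_X4_sq`
  (`z̄² = −x̄⁴z̄ − x̄²(ȳ³+ū³+t̄³)`), `mk_X0_ne_zero`;
* §2 ★★ `exists_chartEquiv_x` (`CharP k 2`) — `k[X]/(g₃) ≃+*` the Rees chart `D(x̄t)` of `Bl_{(x̄,z̄)} U₂`, sending `x̄ ↦ x̄/1` (res-L1-w45a-lead-1's ✓ p643799
  `StrictTransformChartSub.strictTransformChartSub`): THE FLOOR-2 → FLOOR-3 LINK of the N-tower (U₃ is an open of `Bl_{S₂} U₂`, `S₂ = (x, z)`);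
* §3 ★ `height_centre : height 𝔮 = 1` (`𝔮` is minimal over `(x̄)` since `z̄² ∈ (x̄)`; `𝔮 ≠ ⊥`), ★★ `not_fullCl_atPrime_centre` — `¬ FullCl 2 (A_𝔮)` over ANY field:
  `dim A_𝔮 = 1`, `(x̄)` is a system of parameters, **`z̄² = x̄²·(−x̄²z̄ − (ȳ³+ū³+t̄³)) ∈ (x̄)^{[2]}` but `z̄ ∉ x̄A_𝔮`** — the witness map `A_𝔮 → F[ε]`
  (`F = Frac k[X]`; `x ↦ 0`, `z ↦ ε`, `y, u, t ↦ y, u, t`) kills `g₂` and `(x̄)`, sends `A ∖ 𝔮` to units and `z̄` to `ε ≠ 0`;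
* §4 ★★ `not_fullCl_localization_of_centre_le` / `not_fullCl_stalk_of_centre_le` (`CharP k 2`) — **EVERY point `w ⊇ 𝔮` of `U₂` is NON-FULL** (FULL at `w` would
  localize to FULL at `𝔮`, `ClauseOfMaximal.fiClause_atPrime_of_le`): THE «⊇» HALF of the floor-2 locus lemma «nonFull(U₂) = V(x̄, z̄)»; the «⊆» half
  (FULL off `V(x̄, z̄)`: root coefficients `x²` on `D(x)` and `z` on `D(z)`) is the sequel file.
[cite: GortzWedhorn2020, (13.19)] [cite: Fedder1983, Prop. 1.7 (context)] [cite: Matsumura1987, Thm. 13.5]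
-/

-- single-problem summit: the doubled namespace component is forced
set_option linter.dupNamespace false

noncomputable section

open AlgebraicGeometry CategoryTheory Literature.AlgebraicGeometry.Resolution TopologicalSpace IsLocalRing MvPolynomial DualNumber

namespace Summit.ResolutionOfSingularities.ResolutionOfSingularities.Theorems.FInjectiveMacaulayfication.NonFullLoopFloorTwo

open Summit.ResolutionOfSingularities.ResolutionOfSingularities.Theorems.FInjectiveMacaulayfication
open SliceableCentre

variable (k : Type) [Field k]

/-! ## §1 The sub-centre chart identity; ring facts on `g₂` -/

/-- ★ **THE CHART IDENTITY OF FLOOR 2** (centre `(x, z)`, chart `x`): `g₂(x, y, u, t, xz) = x²·g₃`. [folklore] -/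
theorem theta_x (g₂ : MvPolynomial (Fin 5) k) (hg₂ : g₂ = X 4 ^ 2 + X 0 ^ 4 * X 4 + X 0 ^ 2 * X 1 ^ 3 + X 0 ^ 2 * X 2 ^ 3 + X 0 ^ 2 * X 3 ^ 3)
    (g₃ : MvPolynomial (Fin 5) k) (hg₃ : g₃ = X 4 ^ 2 + X 0 ^ 3 * X 4 + X 1 ^ 3 + X 2 ^ 3 + X 3 ^ 3) :
    aeval (fun j : Fin 5 => if j ∈ ({0, 4} : Finset (Fin 5)) ∧ j ≠ 0 then X j * X 0 else (X j : MvPolynomial (Fin 5) k)) g₂ = X 0 ^ 2 * g₃ := by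
  subst hg₂; subst hg₃
  simp
  ring

/-- `g₂ ∈ (xⱼ : j ∈ s)` as soon as `0, 4 ∈ s` (`g₂ = z·(z + x⁴) + x·x(y³+u³+t³)`). [folklore] -/
theorem g₂_mem_span_X_image (g₂ : MvPolynomial (Fin 5) k) (hg₂ : g₂ = X 4 ^ 2 + X 0 ^ 4 * X 4 + X 0 ^ 2 * X 1 ^ 3 + X 0 ^ 2 * X 2 ^ 3 + X 0 ^ 2 * X 3 ^ 3)
    (s : Set (Fin 5)) (h0 : (0 : Fin 5) ∈ s) (h4 : (4 : Fin 5) ∈ s) : g₂ ∈ Ideal.span (X '' s : Set (MvPolynomial (Fin 5) k)) := by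
  have hx : (X 0 : MvPolynomial (Fin 5) k) ∈ Ideal.span (X '' s : Set (MvPolynomial (Fin 5) k)) := Ideal.subset_span ⟨0, h0, rfl⟩
  have hz : (X 4 : MvPolynomial (Fin 5) k) ∈ Ideal.span (X '' s : Set (MvPolynomial (Fin 5) k)) := Ideal.subset_span ⟨4, h4, rfl⟩
  have hdec : g₂ = X 4 * (X 4 + X 0 ^ 4) + X 0 * (X 0 * (X 1 ^ 3 + X 2 ^ 3 + X 3 ^ 3)) := by rw [hg₂]; ring
  rw [hdec]
  exact Ideal.add_mem _ (Ideal.mul_mem_right _ _ hz) (Ideal.mul_mem_right _ _ hx)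

/-- ★ In `A = k[X]/(g₂)`: `z̄² = −x̄⁴z̄ − x̄²(ȳ³+ū³+t̄³)`. [certificate] -/
theorem mk_X4_sq (g₂ : MvPolynomial (Fin 5) k) (hg₂ : g₂ = X 4 ^ 2 + X 0 ^ 4 * X 4 + X 0 ^ 2 * X 1 ^ 3 + X 0 ^ 2 * X 2 ^ 3 + X 0 ^ 2 * X 3 ^ 3) :
    Ideal.Quotient.mk (Ideal.span {g₂}) (X 4) ^ 2 =
      -(Ideal.Quotient.mk (Ideal.span {g₂}) (X 0) ^ 4 * Ideal.Quotient.mk (Ideal.span {g₂}) (X 4)) -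
        Ideal.Quotient.mk (Ideal.span {g₂}) (X 0) ^ 2 *
          (Ideal.Quotient.mk (Ideal.span {g₂}) (X 1) ^ 3 + Ideal.Quotient.mk (Ideal.span {g₂}) (X 2) ^ 3 + Ideal.Quotient.mk (Ideal.span {g₂}) (X 3) ^ 3) := by
  have h0 : Ideal.Quotient.mk (Ideal.span {g₂}) g₂ = 0 := Ideal.Quotient.eq_zero_iff_mem.mpr (Ideal.subset_span rfl)
  have hid : (X 4 : MvPolynomial (Fin 5) k) ^ 2 = -(X 0 ^ 4 * X 4) - X 0 ^ 2 * (X 1 ^ 3 + X 2 ^ 3 + X 3 ^ 3) + g₂ := by rw [hg₂]; ring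
  have h1 := congrArg (Ideal.Quotient.mk (Ideal.span {g₂})) hid
  rw [map_add, h0, add_zero] at h1
  simpa only [map_sub, map_neg, map_mul, map_pow, map_add] using h1

/-- `x̄ ≠ 0` in `A` (`g₂ ∤ x`). [plumbing] -/
theorem mk_X0_ne_zero (g₂ : MvPolynomial (Fin 5) k) (hg₂ : g₂ = X 4 ^ 2 + X 0 ^ 4 * X 4 + X 0 ^ 2 * X 1 ^ 3 + X 0 ^ 2 * X 2 ^ 3 + X 0 ^ 2 * X 3 ^ 3) :
    Ideal.Quotient.mk (Ideal.span {g₂}) (X 0) ≠ 0 := fun h0 =>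
  PrimeTransfer.X_not_mem_span_of_isPrime (i := 0) (NonFullLoopFloorOne.isPrime_span_g₂ k _ rfl g₂ hg₂).2
    (NonFullLoopFloorOne.g₂_not_mem_span_X0 k g₂ hg₂) (Ideal.Quotient.eq_zero_iff_mem.mp h0)

/-! ## §2 The floor-2 → floor-3 link: `k[X]/(g₃)` is the `x`-chart of `Bl_{(x̄,z̄)} U₂` -/

set_option maxHeartbeats 800000 in
-- chart-ring types are expensive to unify (as in `StrictTransformChartSub`)
/-- ★★ **`U₃ = Spec k[X]/(g₃)` IS THE REES CHART `D(x̄t)` OF THE BLOW-UP OF `U₂` ALONG `(x̄, z̄)`**: a ring isomorphism onto `(A₂[𝔮t])_{(x̄t)}`,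
`A₂ = k[X]/(g₂)`, `𝔮 = (x̄, z̄)`, sending `x̄ ↦ x̄/1`. [folklore; res-L1-w45a-lead-1's `StrictTransformChartSub.strictTransformChartSub`; cite: GortzWedhorn2020, (13.19)] -/
theorem exists_chartEquiv_x [CharP k 2] (g₂ : MvPolynomial (Fin 5) k) (hg₂ : g₂ = X 4 ^ 2 + X 0 ^ 4 * X 4 + X 0 ^ 2 * X 1 ^ 3 + X 0 ^ 2 * X 2 ^ 3 + X 0 ^ 2 * X 3 ^ 3)
    (g₃ : MvPolynomial (Fin 5) k) (hg₃ : g₃ = X 4 ^ 2 + X 0 ^ 3 * X 4 + X 1 ^ 3 + X 2 ^ 3 + X 3 ^ 3) :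
    ∃ e : (MvPolynomial (Fin 5) k ⧸ Ideal.span {g₃}) ≃+*
        HomogeneousLocalization.Away (reesGrading (Ideal.span ((fun j : Fin 5 => Ideal.Quotient.mk (Ideal.span {g₂}) (X j)) '' (({0, 4} : Finset (Fin 5)) : Set (Fin 5)))))
          (reesT ((fun j : Fin 5 => Ideal.Quotient.mk (Ideal.span {g₂}) (X j)) 0)
            (StrictTransformChartSub.mem_centre (fun j : Fin 5 => Ideal.Quotient.mk (Ideal.span {g₂}) (X j)) ({0, 4} : Finset (Fin 5)) (i := 0) (by simp))),
      e (Ideal.Quotient.mk (Ideal.span {g₃}) (X 0)) =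
        reesChartBase ((fun j : Fin 5 => Ideal.Quotient.mk (Ideal.span {g₂}) (X j)) 0)
          (StrictTransformChartSub.mem_centre (fun j : Fin 5 => Ideal.Quotient.mk (Ideal.span {g₂}) (X j)) ({0, 4} : Finset (Fin 5)) (i := 0) (by simp))
          ((fun j : Fin 5 => Ideal.Quotient.mk (Ideal.span {g₂}) (X j)) 0) := by
  have h3 : (Ideal.span {g₃}).IsPrime := (Ideal.span_singleton_prime (NonFullLoopFloorThree.prime_g₃ k g₃ hg₃).ne_zero).mpr (NonFullLoopFloorThree.prime_g₃ k g₃ hg₃)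
  exact StrictTransformChartSub.strictTransformChartSub k 5 g₂ g₃ ({0, 4} : Finset (Fin 5)) 0 (by simp) 2 h3
    (PrimeTransfer.X_not_mem_span_of_isPrime h3 (NonFullLoopFloorThree.g₃_not_mem_span_X0 k g₃ hg₃)) (theta_x k g₂ hg₂ g₃ hg₃) _ rfl

/-! ## §3 ★★ The local ring at the centre `𝔮 = (x̄, z̄)` is one-dimensional and NOT FULL (any field) -/

/-- ★ **`height 𝔮 = 1`**: `𝔮` is minimal over `(x̄)` (`z̄² ∈ (x̄)`), so `height 𝔮 ≤ 1` (Krull); and `𝔮 ≠ ⊥` in the domain `A`. [cite: Matsumura1987, Thm. 13.5] -/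
theorem height_centre (g₂ : MvPolynomial (Fin 5) k) (hg₂ : g₂ = X 4 ^ 2 + X 0 ^ 4 * X 4 + X 0 ^ 2 * X 1 ^ 3 + X 0 ^ 2 * X 2 ^ 3 + X 0 ^ 2 * X 3 ^ 3) :
    (Ideal.span ((fun j : Fin 5 => Ideal.Quotient.mk (Ideal.span {g₂}) (X j)) '' (({0, 4} : Finset (Fin 5)) : Set (Fin 5)))).height = 1 := by
  classical
  haveI := (NonFullLoopFloorOne.isPrime_span_g₂ k _ rfl g₂ hg₂).2
  haveI : IsDomain (MvPolynomial (Fin 5) k ⧸ Ideal.span {g₂}) := Ideal.Quotient.isDomain _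
  set mk : MvPolynomial (Fin 5) k →+* MvPolynomial (Fin 5) k ⧸ Ideal.span {g₂} := Ideal.Quotient.mk (Ideal.span {g₂}) with hmk
  haveI h𝔮 : (Ideal.span ((fun j : Fin 5 => Ideal.Quotient.mk (Ideal.span {g₂}) (X j)) '' (({0, 4} : Finset (Fin 5)) : Set (Fin 5)))).IsPrime :=
    NonFullLoopFloorFive.isPrime_span_image_mk k g₂ _ (g₂_mem_span_X_image k g₂ hg₂ _ (by simp) (by simp))
  have hz2 := mk_X4_sq k g₂ hg₂
  apply le_antisymm
  · -- `≤ 1`: minimal over `(x̄)`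
    have hmin : Ideal.span ((fun j : Fin 5 => Ideal.Quotient.mk (Ideal.span {g₂}) (X j)) '' (({0, 4} : Finset (Fin 5)) : Set (Fin 5))) ∈
        (Ideal.span (({mk (X 0)} : Finset (MvPolynomial (Fin 5) k ⧸ Ideal.span {g₂})) : Set (MvPolynomial (Fin 5) k ⧸ Ideal.span {g₂}))).minimalPrimes := by
      refine ⟨⟨h𝔮, ?_⟩, ?_⟩
      · rw [Finset.coe_singleton, Ideal.span_le, Set.singleton_subset_iff]
        exact Ideal.subset_span ⟨0, by simp, rfl⟩
      · rintro q ⟨hq, hxq⟩ hq𝔮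
        rw [Finset.coe_singleton, Ideal.span_le, Set.singleton_subset_iff] at hxq
        have hx : mk (X 0) ∈ q := hxq
        have hz : mk (X 4) ∈ q := by
          apply hq.mem_of_pow_mem 2
          rw [hz2]
          exact Ideal.sub_mem _ (Submodule.neg_mem _ (Ideal.mul_mem_right _ _ (Ideal.pow_mem_of_mem _ hx 4 (by norm_num))))
            (Ideal.mul_mem_right _ _ (Ideal.pow_mem_of_mem _ hx 2 two_pos))
        rw [Ideal.span_le]
        rintro _ ⟨j, hj, rfl⟩
        simp only [Finset.coe_insert, Finset.coe_singleton, Set.mem_insert_iff, Set.mem_singleton_iff] at hj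
        rcases hj with rfl | rfl
        · exact hx
        · exact hz
    refine (Ideal.height_le_card_of_mem_minimalPrimes_span_finset hmin).trans ?_
    exact_mod_cast (Finset.card_singleton _).le
  · -- `≥ 1`: `𝔮 ≠ ⊥`
    have h𝔮0 : Ideal.span ((fun j : Fin 5 => Ideal.Quotient.mk (Ideal.span {g₂}) (X j)) '' (({0, 4} : Finset (Fin 5)) : Set (Fin 5))) ≠ ⊥ := fun hbot =>
      mk_X0_ne_zero k g₂ hg₂ ((Submodule.eq_bot_iff _).mp hbot _ (Ideal.subset_span ⟨0, by simp, rfl⟩))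
    rw [Order.one_le_iff_ne_zero, Ne, Ideal.height_eq_zero_iff_eq_bot]
    exact h𝔮0

set_option maxHeartbeats 800000 in
-- one localization lift into `Frac(k[X])[ε]` + several ideal-membership computations (same budget as `NonFullLoopFloorFiveCentre.not_fullCl_atPrime_centre`)
/-- ★★ **`¬ FullCl 2 (A_𝔮)` AT THE GENERIC POINT `𝔮 = (x̄, z̄)` OF THE CENTRE** (ANY field `k`): `dim A_𝔮 = 1`; `(x̄)` is a system of parameters (`z̄² ∈ (x̄)`);
`z̄² = x̄²·(−x̄²z̄ − (ȳ³+ū³+t̄³)) ∈ (x̄)^{[2]}`; but `z̄ ∉ x̄A_𝔮` — the map `A_𝔮 → F[ε]`, `F = Frac k[X]`, `x ↦ 0`, `z ↦ ε`, `y, u, t ↦ y, u, t` kills `g₂` and `(x̄)`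
and sends `z̄` to `ε ≠ 0` (elements off `𝔮` go to units). So the Frobenius-closure clause of `FullCl 2` fails for the parameter ideal `(x̄)` — tri-2's
`I₁(g₂) = (xt, xu, xy, x², z) ⊆ 𝔮`, the dim-1 Frobenius witness. [OURS · certificate; cite: Fedder1983, Prop. 1.7 (context)] -/
theorem not_fullCl_atPrime_centre (g₂ : MvPolynomial (Fin 5) k) (hg₂ : g₂ = X 4 ^ 2 + X 0 ^ 4 * X 4 + X 0 ^ 2 * X 1 ^ 3 + X 0 ^ 2 * X 2 ^ 3 + X 0 ^ 2 * X 3 ^ 3)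
    (Q : Ideal (MvPolynomial (Fin 5) k ⧸ Ideal.span {g₂})) [Q.IsPrime]
    (hQ : Q = Ideal.span ((fun j : Fin 5 => Ideal.Quotient.mk (Ideal.span {g₂}) (X j)) '' (({0, 4} : Finset (Fin 5)) : Set (Fin 5)))) :
    ¬ FullCl 2 (Localization.AtPrime Q) := by
  intro hfull
  set R := MvPolynomial (Fin 5) k ⧸ Ideal.span {g₂} with hR
  set mk : MvPolynomial (Fin 5) k →+* R := Ideal.Quotient.mk (Ideal.span {g₂}) with hmk
  set L := Localization.AtPrime Q with hL
  set alg : R →+* L := algebraMap R L with halg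
  -- (1) the dimension
  have hdim : ringKrullDim L = (1 : ℕ) := by
    rw [IsLocalization.AtPrime.ringKrullDim_eq_height Q L, hQ, height_centre k g₂ hg₂]
    rfl
  -- (2) the system of parameters `(x̄)`
  set s : Fin 1 → L := ![alg (mk (X 0))] with hs
  have hx0 : alg (mk (X 0)) ∈ Ideal.span (Set.range s) := Ideal.subset_span ⟨0, rfl⟩
  have hz2 : alg (mk (X 4)) ^ 2 = alg (mk (X 0)) ^ 2 * (-(alg (mk (X 0)) ^ 2 * alg (mk (X 4))) -
      (alg (mk (X 1)) ^ 3 + alg (mk (X 2)) ^ 3 + alg (mk (X 3)) ^ 3)) := by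
    have h := congrArg alg (mk_X4_sq k g₂ hg₂)
    simp only [map_pow, map_sub, map_neg, map_mul, map_add] at h
    rw [h]; ring
  have hz2mem : alg (mk (X 4)) ^ 2 ∈ Ideal.span (Set.range s) := by
    rw [hz2]
    exact Ideal.mul_mem_right _ _ (Ideal.pow_mem_of_mem _ hx0 2 two_pos)
  have hmaxL : IsLocalRing.maximalIdeal L = Q.map alg := (Localization.AtPrime.map_eq_maximalIdeal (I := Q)).symm
  have hle : Ideal.span (Set.range s) ≤ IsLocalRing.maximalIdeal L := by
    rw [Ideal.span_le]
    rintro _ ⟨j, rfl⟩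
    rw [hmaxL]
    fin_cases j
    exact Ideal.mem_map_of_mem _ (by rw [hQ]; exact Ideal.subset_span ⟨0, by simp, rfl⟩)
  have hrad_eq : (Ideal.span (Set.range s)).radical = IsLocalRing.maximalIdeal L := by
    apply le_antisymm
    · exact (Ideal.radical_mono hle).trans_eq (IsLocalRing.maximalIdeal.isMaximal L).isPrime.radical
    · rw [hmaxL]
      refine Ideal.map_le_iff_le_comap.mpr fun q hq => ?_
      rw [hQ] at hq
      refine (Ideal.span_le.mpr ?_) hq
      rintro _ ⟨j, hj, rfl⟩
      simp only [Finset.coe_insert, Finset.coe_singleton, Set.mem_insert_iff, Set.mem_singleton_iff] at hj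
      rw [SetLike.mem_coe, Ideal.mem_comap]
      rcases hj with rfl | rfl
      · exact Ideal.le_radical hx0
      · exact ⟨2, hz2mem⟩
  have hrad : (Ideal.span (Set.range s)).radical.IsMaximal := by
    rw [hrad_eq]; exact IsLocalRing.maximalIdeal.isMaximal L
  -- (3) the Frobenius-closure clause of `FullCl 2` at `y = z̄`, `e = 1`
  obtain ⟨-, hclause⟩ := hfull
  have hF3 := (hclause 1 hdim s hrad).2 (alg (mk (X 4))) ⟨1, by
    rw [pow_one, hz2]
    exact Ideal.mul_mem_right _ _ (Ideal.subset_span ⟨alg (mk (X 0)), hx0, rfl⟩)⟩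
  -- (4) `z̄ ∉ (x̄) A_𝔮`: evaluate into the dual numbers over `F = Frac k[X]`
  let Fr := FractionRing (MvPolynomial (Fin 5) k)
  let ι : MvPolynomial (Fin 5) k →+* Fr := algebraMap _ _
  let f : k →+* Fr[ε] := (TrivSqZeroExt.inlHom Fr Fr).comp (ι.comp MvPolynomial.C)
  let v : Fin 5 → Fr[ε] := fun j => if j = 4 then ε else if j = 0 then 0 else TrivSqZeroExt.inl (ι (X j))
  have hv4 : v 4 = ε := by simp [v]
  have hv0 : v 0 = 0 := by simp [v]
  have hε2 : (ε : Fr[ε]) ^ 2 = 0 := by rw [pow_two, DualNumber.eps_mul_eps]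
  have hφg : eval₂Hom f v g₂ = 0 := by
    rw [hg₂]
    simp only [map_add, map_mul, map_pow, eval₂Hom_X', hv4, hv0, hε2, zero_pow two_ne_zero, zero_pow (by norm_num : (4 : ℕ) ≠ 0), zero_mul,
      add_zero]
  let φ₁ : R →+* Fr[ε] := Ideal.Quotient.lift (Ideal.span {g₂}) (eval₂Hom f v) fun a ha => by
    obtain ⟨c, rfl⟩ := Ideal.mem_span_singleton'.mp ha
    rw [map_mul, hφg, mul_zero]
  have hφ₁ : ∀ q : MvPolynomial (Fin 5) k, φ₁ (mk q) = eval₂Hom f v q := fun q => Ideal.Quotient.lift_mk _ _ _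
  -- the first component of `eval₂Hom f v` is `ι ∘ (x, z ↦ 0)`
  have hfst : ∀ q : MvPolynomial (Fin 5) k, TrivSqZeroExt.fst (eval₂Hom f v q) =
      ι (aeval (fun i : Fin 5 => if i ∈ ((({0, 4} : Finset (Fin 5)) : Set (Fin 5))) then (0 : MvPolynomial (Fin 5) k) else X i) q) := by
    intro q
    have hcomp : (TrivSqZeroExt.fstHom Fr Fr Fr).toRingHom.comp (eval₂Hom f v) =
        ι.comp (aeval (fun i : Fin 5 => if i ∈ ((({0, 4} : Finset (Fin 5)) : Set (Fin 5))) then (0 : MvPolynomial (Fin 5) k) else X i)).toRingHom := by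
      refine MvPolynomial.ringHom_ext (fun a => ?_) (fun j => ?_)
      · simp [f, TrivSqZeroExt.inlHom]
      · fin_cases j <;> simp [v]
    have h1 := RingHom.congr_fun hcomp q
    change TrivSqZeroExt.fst (eval₂Hom f v q) = ι (aeval _ q) at h1
    exact h1
  have hunit : ∀ y : Q.primeCompl, IsUnit (φ₁ y) := by
    rintro ⟨y, hy'⟩
    obtain ⟨q, rfl⟩ := Ideal.Quotient.mk_surjective y
    change IsUnit (φ₁ (mk q))
    rw [hφ₁, TrivSqZeroExt.isUnit_iff_isUnit_fst, hfst, isUnit_iff_ne_zero]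
    intro hc
    apply hy'
    have hc' : aeval (fun i : Fin 5 => if i ∈ ((({0, 4} : Finset (Fin 5)) : Set (Fin 5))) then (0 : MvPolynomial (Fin 5) k) else X i) q = 0 :=
      (IsFractionRing.injective (MvPolynomial (Fin 5) k) Fr) (by rw [map_zero]; exact hc)
    have hq : q ∈ Ideal.span (X '' ((({0, 4} : Finset (Fin 5)) : Set (Fin 5))) : Set (MvPolynomial (Fin 5) k)) := by
      rw [← Literature.RingTheory.MvPolynomial.ker_aeval_ite_eq_span]; exact hc'
    have := Ideal.mem_map_of_mem mk hq
    rw [← NonFullLoopFloorFive.span_image_mk_eq_map] at this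
    change mk q ∈ Q
    rw [hQ]; exact this
  let ψ : L →+* Fr[ε] := IsLocalization.lift (M := Q.primeCompl) (g := φ₁) hunit
  have hψ : ∀ r : R, ψ (alg r) = φ₁ r := fun r => IsLocalization.lift_eq (M := Q.primeCompl) hunit r
  -- `ψ` kills `(s) = (x̄)` …
  have hψs : ∀ w ∈ Ideal.span (Set.range s), ψ w = 0 := by
    intro w hw
    have hmap : Ideal.span (Set.range s) ≤ RingHom.ker ψ := by
      rw [Ideal.span_le]
      rintro _ ⟨j, rfl⟩
      rw [SetLike.mem_coe, RingHom.mem_ker, hs]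
      fin_cases j
      change ψ (alg (mk (X 0))) = 0
      rw [hψ, hφ₁, eval₂Hom_X', hv0]
    exact hmap hw
  -- … but not `z̄ ↦ ε`
  have hε : ψ (alg (mk (X 4))) = ε := by
    rw [hψ, hφ₁, eval₂Hom_X', hv4]
  have h0 := hψs _ hF3
  rw [hε] at h0
  have := congrArg TrivSqZeroExt.snd h0
  rw [DualNumber.snd_eps, TrivSqZeroExt.snd_zero] at this
  exact one_ne_zero this

/-! ## §4 ★★ Every point of `V(x̄, z̄) ⊂ U₂` is NON-FULL (the «⊇» half of the floor-2 locus lemma) -/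

/-- ★★ **`¬ FullCl 2 (A_P)` for EVERY prime `P ⊇ 𝔮 = (x̄, z̄)`** (`char k = 2`): FULL at `P` would localize to FULL at `𝔮 ⊆ P`
(`ClauseOfMaximal.fiClause_atPrime_of_le`), contradicting §3. [OURS · certificate] -/
theorem not_fullCl_localization_of_centre_le [CharP k 2] (g₂ : MvPolynomial (Fin 5) k) (hg₂ : g₂ = X 4 ^ 2 + X 0 ^ 4 * X 4 + X 0 ^ 2 * X 1 ^ 3 + X 0 ^ 2 * X 2 ^ 3 + X 0 ^ 2 * X 3 ^ 3)
    (P : Ideal (MvPolynomial (Fin 5) k ⧸ Ideal.span {g₂})) [P.IsPrime]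
    (hP : Ideal.span ((fun j : Fin 5 => Ideal.Quotient.mk (Ideal.span {g₂}) (X j)) '' (({0, 4} : Finset (Fin 5)) : Set (Fin 5))) ≤ P) :
    ¬ FullCl 2 (Localization.AtPrime P) := by
  haveI : Fact (Nat.Prime 2) := ⟨Nat.prime_two⟩
  haveI := (NonFullLoopFloorOne.isPrime_span_g₂ k _ rfl g₂ hg₂).2
  haveI : IsDomain (MvPolynomial (Fin 5) k ⧸ Ideal.span {g₂}) := Ideal.Quotient.isDomain _
  haveI : CharP (MvPolynomial (Fin 5) k ⧸ Ideal.span {g₂}) 2 := charP_of_injective_algebraMap (algebraMap k _).injective 2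
  haveI : (Ideal.span ((fun j : Fin 5 => Ideal.Quotient.mk (Ideal.span {g₂}) (X j)) '' (({0, 4} : Finset (Fin 5)) : Set (Fin 5)))).IsPrime :=
    NonFullLoopFloorFive.isPrime_span_image_mk k g₂ _ (g₂_mem_span_X_image k g₂ hg₂ _ (by simp) (by simp))
  intro hfull
  exact not_fullCl_atPrime_centre k g₂ hg₂ _ rfl (ClauseOfMaximal.fiClause_atPrime_of_le 2 hP hfull)

/-- ★★ **THE «⊇» HALF OF THE FLOOR-2 LOCUS LEMMA** (stalk form): every point `w` of `U₂ = Spec k[X]/(g₂)` with `(x̄, z̄) ≤ w` is NON-FULL (`char k = 2`).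
[OURS · certificate] -/
theorem not_fullCl_stalk_of_centre_le [CharP k 2] (g₂ : MvPolynomial (Fin 5) k) (hg₂ : g₂ = X 4 ^ 2 + X 0 ^ 4 * X 4 + X 0 ^ 2 * X 1 ^ 3 + X 0 ^ 2 * X 2 ^ 3 + X 0 ^ 2 * X 3 ^ 3)
    (w : Spec (.of (MvPolynomial (Fin 5) k ⧸ Ideal.span {g₂})))
    (hw : Ideal.span ((fun j : Fin 5 => Ideal.Quotient.mk (Ideal.span {g₂}) (X j)) '' (({0, 4} : Finset (Fin 5)) : Set (Fin 5))) ≤ w.asIdeal) :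
    ¬ FullCl 2 ((Spec (.of (MvPolynomial (Fin 5) k ⧸ Ideal.span {g₂}))).presheaf.stalk w) := fun hfull =>
  not_fullCl_localization_of_centre_le k g₂ hg₂ w.asIdeal hw
    (WFixAtNonClosedDimTwo.fullCl_of_ringEquiv 2 (Spec.stalkIso (.of _) w).commRingCatIsoToRingEquiv hfull)

end Summit.ResolutionOfSingularities.ResolutionOfSingularities.Theorems.FInjectiveMacaulayfication.NonFullLoopFloorTwo

end
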